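import Mathlib
import Literature.Claims.NS.ClayVariants
import Literature.Analysis.FluidPDE.TaoLocalisation
import Literature.Analysis.FluidPDE.ClassicalSolutionRescale
import HarnessLib

/-!
# CLAIM C20 — Gray Jennings, «Smooth solutions of the Navier-Stokes equations on ℝ³ × [0,∞)»
# (arXiv:2002.08270 [math.GM])

VERSION TYPED: **v6 (2025-03-23)** = the last archived full text (TeX `NS-0322-2025v6.tex`, 9071
lines; PDF 134 pp., PDF page = printed page; `run/shared/lean/pub/ns-claims/sources/Jennings2020/`,
LOCATORS by ns-claims-lit-2). v1 (2020-02-18) has the same architecture (§9 «|u|_{L∞×[0,∞)} ≤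
|u_o|_{L∞}» by the same dilated-data device); **v7 (2026-08-09) is a 1 KB withdrawal stub whose arXiv
comment reads verbatim «error in a proof unable to patch»** (no locator given by the author). Bib key
`Jennings2020`. Every `[cite: …]` names theorem/equation number AND the v6 PDF page.

WHAT THIS FILE IS: a step-wise typing, at the paper's own grain, of the CLAIMED proof that for every
`ν > 0` and every divergence-free `u₀ ∈ ∩_m H^m(ℝ³)` the Navier–Stokes equations have a `C^∞`
solution on `ℝ³ × [0,∞)` with `sup_t |u(t)|_{L^∞} = |u₀|_{L^∞}` and `sup_t |u(t)|_{L²} = |u₀|_{L²}`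
(Theorem 11.1; «Our results are a solution of Option A of the millennium problem», p. 8 and p. 133).
The headline is the `def` `ClaimedTheorem` (a `ClayVariants.ClaySpec.Regularity`, never a `theorem`);
every load-bearing printed assertion is one `def Step… : Prop` with its locator; `claim_of_steps`
(PROVED) composes them in the paper's own order; `clay_of_claimed` (PROVED) gives Fefferman's (A).

WHAT THIS IS NOT: not a claim about NS regularity or blow-up; not an endorsement of any Step; not a
claim about any statement of the author beyond the typed locators of v6.

## Claimed statement (as printed)

Theorem 11.1, p. 131: «Let `u_o` be `∈ ∩_m H^{m,df}` and `ν` be `> 0`. Then `u^ν(x,t;u_o)` is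
`∈ ∩_m[H^{m,df} × [0,∞)]` and its derivatives `∂ₜⁿD^{k'}u^ν` exist on `ℝ³ × [0,∞)` and are
`∈ ∩_m[H^{m,df} × [0,∞)]`. In addition, `p^ν` is `∈ ∩_m[H^{m,df} × [0,∞)]` and its derivatives
`∂ₜⁿD^{k'}p^ν` exist on `ℝ³ × [0,∞)` and are `∈ ∩_m[H^m × [0,∞)]`. `u^ν` and `p^ν` satisfy the
(1.1)_{ν,u_o} pde `∂ₜu^ν + Σⱼ u^ν_j ∂ⱼu^ν = νΔu^ν − grad p^ν`, `u^ν(x,0) = u_o(x)` on `ℝ³ × [0,∞)` and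
`u^ν` satisfies (11.2) `|u^ν|_{L²×[0,∞)} = |u_o|_{L²}` and `|u^ν|_{L^∞×[0,∞)} = |u_o|_{L^∞}`.» Here
(p. 3–4) `∩_m H^{m,df}` = divergence-free fields `ℝ³ → ℝ³` with every derivative in `L²`,
`|v|_{L^∞} := sup_k sup_x |v_k(x)|` (§2 p. 10), `|u|_{L^∞×[0,T]} := sup_{η∈[0,T]} |u(η)|_{L^∞}` (p. 3),
and `H^m × [a,b]` = `v(t) ∈ H^m` with `t ↦ |v(t)|_{H^m}` continuous (p. 4). Closing paragraph p. 133: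
«The functions `u^ν` and `p^ν` satisfy the conditions of (1), (2), (3), (6) and (7) of Option A».

## Architecture of the printed proof (γ = mollification parameter, `J_0 = id`)

§6 T6.2: local solution `u^{γ,m}` of the integral equation (6.1) ⇒ §7 T7.1/L7.3/T7.7: it solves the
mollified–projected pde (7.1) `∂ₜu + P_l[Σⱼ J_γ(u_j)∂ⱼu] = Δu`, uniqueness, `L²` identity, `H^m`
blow-up criterion ⇒ §8 T8.1/T8.2: `L^∞` blow-up criterion, `m`-independence, for `γ > 0` global
existence with the bound (8.22) ⇒ §9 L9.1: SCALING RULE (9.4) `u^γ(x,t;u_o^α) = α u^γ(xα,tα²;u_o)`,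
`u_o^α(x) := α u_o(xα)`, at FIXED `γ ≥ 0` ⇒ T9.2: (8.22) for the data `u_o^α` + (9.4) + `α → ∞` ⇒
(9.11) `|u^{γ>0}|_{L^∞×[0,∞)} = |u_o|_{L^∞}`; `γ → 0⁺` (Arzelà–Ascoli, uniqueness) ⇒ the same for
`u^{γ=0}` ⇒ global ⇒ §10 `C^∞` ⇒ §11 T11.1 `ν`-rescaling.

## Ordered Step index (`claim_of_steps` consumes the Steps in this order)

* `Step1_DataDilation`   — p. 109 l.7280–7283: `u_o^α := α u_o(xα)` «which the chain rule shows is `∈ ∩_m H^{m,df}`» (and `u_o(xν)`, §11).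
* `Step2_LocalExistence` — T6.2 p. 63 with T7.1 p. 75, T8.2 p. 105: a solution of (7.1)_{γ,u_o} on `[0,T_bup^γ(u_o))`, `T_bup > 0`.
* `Step3_Uniqueness`     — L7.3 p. 86.
* `Step4_L2_Blowup`      — T7.7 (1.5)/(7.51) p. 95 (`L²` identity) and T8.1/T8.2 (8.1)/(8.21) p. 98, 105 (`L^∞` blow-up criterion).
* `Step5_T82_gammaPos`   — T8.2 (8.19), (8.22) p. 105: for `γ > 0`, `T_bup = ∞` and the affine `L^∞` bound (8.22).
* `Step6_ScalingRule`    — **L9.1 (9.4) p. 109** (u-level, as printed): the dilate of the solution from `u_o` solves (7.1)_{γ,u_o^α}.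
* `Step6b_JDilation`     — **(9.5) → (9.6), p. 110, «The chain rule then shows»**: the dilation covariance of the
                           FIXED-scale mollifier `J_{γ>0}` used for the `J`-term (operator level, the grain at which
                           the display argues).
* `Step6c_PlDilation`    — (9.6) → (9.7), p. 110, «(4.14) shows»: dilation covariance of the projector `P_l` (true; typed for completeness).
* `Step7_SupBound_911`   — **T9.2 proof step 1, (9.11) p. 111–112**: `|u^{γ>0}|_{L^∞×[0,∞)} ≤ |u_o|_{L^∞}` (from (8.22) + (9.4) + `α → ∞`).
* `Step8_GammaZero`      — T9.2 proof step 2, (9.12)–(9.13) p. 112–115: `γ → 0⁺`; `|u^{γ=0}| ≤ |u_o|_{L^∞}`, `T_bup^{γ=0} = ∞`.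
* `Step9_Smooth`         — §10 L10.1–L10.4 p. 116–130 and §11 p. 131 first part: `u^{γ=0}, p^{γ=0} ∈ C^∞`, solve (1.1)_{ν=1}.
* `Step10_NuRescaling`   — T11.1 (11.1)–(11.2) p. 131–133.

## Clay delta (reference `Literature/Claims/NS/ClayVariants.lean`; (A) = `ClayVariants.clayR3.Regularity`)

Nearest: (A). Δ1 domain `ℝ³` «=» · Δ2 force `≡ 0` «=» · Δ3 data `∩_m H^{m,df}` ⊇ Clay (4)
(`HasRapidSpatialDecay.lintegral_enorm_iteratedFDeriv_sq_lt_top`) ⇒ STRONGER side (`Regularity.mono`) ·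
Δ4 solution class `C^∞(ℝ³ × [0,∞))` «=»; (7) bounded energy ⇐ the printed `L²` identity «=» · horizon
`[0,∞)` «=» · every `ν > 0` «=». `clay_of_claimed : ClaimedTheorem → clayR3.Regularity` is PROVED:
no wrong-problem axis. (The closing paragraph p. 133 misprints Clay's (4) as «`|D^{k'}u_o(x)| ≤ C_{k',K}`»
without the factor `(1+|x|)^{−K}`; immaterial here since the data inclusion is proved from the tree's (4).)
-/

open Set Function MeasureTheory Filter Topology
open scoped ContDiff ENNReal NNReal Laplacian

namespace Literature.Claims.NS.Jennings2020

open Literature.Analysis.FluidPDE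

/-! ## Vocabulary -/

/-- `ℝ³`. [cite: Jennings2020, §1 p.1] -/
abbrev E3 : Type := EuclideanSpace ℝ (Fin 3)

/-- `|v|_{L^∞} := sup_k sup_{x∈ℝ³} |v_k(x)|` (§2, p. 10) — a supremum over points and components (the
paper's fields are continuous, `H² ⊂ C⁰`, (2.14)), in `ℝ≥0∞`. [cite: Jennings2020, §2 p.10] -/
noncomputable def linf (v : E3 → E3) : ℝ≥0∞ := ⨆ (x : E3) (k : Fin 3), ‖v x k‖ₑ

/-- `|v|²_{L²} = ∫ (v,v)₂ dx` (§2 p. 9–10), as a lower Lebesgue integral. [cite: Jennings2020, §2 p.9–10] -/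
noncomputable def l2sq (v : E3 → E3) : ℝ≥0∞ := ∫⁻ x, ‖v x‖ₑ ^ 2

/-- `v ∈ ∩_m H^m` for a field with values in `F` (p. 3–4: «together with each derivative `D^{k'}v ∈ L²`»;
here with the full `n`-th Fréchet derivative, equivalent up to constants). [cite: Jennings2020, §1 p.3–4] -/
def IsHInf {F : Type*} [NormedAddCommGroup F] [NormedSpace ℝ F] (v : E3 → F) : Prop :=
  ∀ n : ℕ, ∫⁻ x, ‖iteratedFDeriv ℝ n v x‖ₑ ^ 2 < ⊤

/-- The `H^n`-seminorm value `(∫ ‖Dⁿv‖²)^{1/2}` as a real (for the continuity clause of `H^m × [a,b]`,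
p. 4: «`|v(t)|_{H^m}` is a continuous function of `t`»). [cite: Jennings2020, §1 p.4] -/
noncomputable def hn (n : ℕ) (v : E3 → E3) : ℝ :=
  ((∫⁻ x, ‖iteratedFDeriv ℝ n v x‖ₑ ^ 2) ^ (1 / 2 : ℝ)).toReal

/-- The data class `∩_m H^{m,df}` (p. 3–4): divergence free, every derivative in `L²`; `C^∞` added
explicitly (implied by `∩_m H^m ⊂ C^∞`, (2.14)). [cite: Jennings2020, §1 p.3–4] -/
def InData (u₀ : E3 → E3) : Prop :=
  ContDiff ℝ (⊤ : ℕ∞) u₀ ∧ IsHInf u₀ ∧ NSWave0.IsDivFree u₀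

/-- The dilated datum (9.3) p. 109: `u_o^α(x) := α u_o(xα)`; with `c = 1, a = ν` also the datum
`u_o(xν)` of (11.1) p. 131. [cite: Jennings2020, (9.3) p.109, (11.1) p.131] -/
noncomputable def dilData (c a : ℝ) (u₀ : E3 → E3) : E3 → E3 := fun x => c • u₀ (a • x)

/-- The space-time dilate `(x,t) ↦ α u(xα, tα²)` of L9.1 (9.4) p. 109. [cite: Jennings2020, (9.4) p.109] -/
noncomputable def dilSol (α : ℝ) (u : ℝ → E3 → E3) : ℝ → E3 → E3 := fun t x => α • u (α ^ 2 * t) (α • x)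

/-- The standard mollifier `m†` of [4] Appendix C.5 (Evans): `C exp(1/(|y|²−1))` on `|y| < 1`, `0`
outside, normalised to integral one (p. 6). [cite: Jennings2020, §1 p.6] -/
noncomputable def bump (y : E3) : ℝ := if ‖y‖ < 1 then Real.exp (1 / (‖y‖ ^ 2 - 1)) else 0

/-- `m†` normalised (p. 6). [cite: Jennings2020, §1 p.6] -/
noncomputable def mDag (y : E3) : ℝ := bump y / ∫ z, bump z

/-- `m†_γ(y) := γ⁻³ m†(y γ⁻¹)` (p. 6). [cite: Jennings2020, §1 p.6] -/
noncomputable def mGam (γ : ℝ) (y : E3) : ℝ := (γ⁻¹) ^ 3 * mDag (γ⁻¹ • y)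

/-- The mollifier `J_γ` acting on a vector field componentwise: `J_{γ>0}(v)(x) = ∫ m†_γ(y) v(x−y) dy`,
`J_0 = id` (p. 6 (1.?) and (3.?) §3). [cite: Jennings2020, §1 p.6] -/
noncomputable def Jmol (γ : ℝ) (v : E3 → E3) : E3 → E3 :=
  if γ = 0 then v else fun x => ∫ y, mGam γ y • v (x - y)

/-- The Newtonian potential `N φ(x) = −(4π)⁻¹ ∫ |x−y|⁻¹ φ(y) dy` (`Δ N φ = φ`), used for the
Helmholtz–Hodge projector of §4 and the pressure formula of §10. [cite: Jennings2020, §4 p.34–35, §10 p.116] -/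
noncomputable def newton (φ : E3 → ℝ) (x : E3) : ℝ := ∫ y, -(4 * Real.pi * ‖x - y‖)⁻¹ * φ y

/-- The projector `P_l` onto divergence-free fields of the Helmholtz–Hodge decomposition
`v = P_g v + P_l v` (§4 p. 34–46, L4.1–L4.4): `P_l v = v − ∇Δ⁻¹(div v)`. [cite: Jennings2020, §4 p.34–35] -/
noncomputable def lerayProj (v : E3 → E3) : E3 → E3 :=
  fun x => v x - gradient (newton (VectorCalculus.divergence v)) x

/-- The time strip `[0,T)` for `T ∈ (0,∞]`. [cite: Jennings2020, §1 p.3–4] -/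
def strip (T : ℝ≥0∞) : Set ℝ := {t : ℝ | 0 ≤ t ∧ ENNReal.ofReal t < T}

/-- SOLUTION OF THE MOLLIFIED–PROJECTED PDE (7.1)_{k'=0,γ,u_o} on `ℝ³ × [0,T)` in the class
`∩_m[H^{m,df} × [0,T)]` with `∂ₜu` existing (T7.1 p. 75, L7.3 p. 86, T8.2 p. 105):
`∂ₜu(x,t) + P_l[Σⱼ J_γ(u_j) ∂ⱼu](x,t) = Δu(x,t)`, `u(x,0) = u_o(x)`; `Σⱼ J_γ(u_j)∂ⱼu` is the convective
derivative of `u(t)` along `J_γ u(t)` (`convect`). Joint smoothness on the strip is included (the class in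
which §9–§11 finally work; it narrows the class, so every universally quantified Step below is weaker
than printed). [cite: Jennings2020, (7.1) p.75, L7.3 p.86, T8.2 (8.18) p.105] -/
structure MolSol (γ : ℝ) (u₀ : E3 → E3) (T : ℝ≥0∞) (u : ℝ → E3 → E3) : Prop where
  smooth : IsSmoothSpaceTimeOn (strip T) u
  hInf : ∀ t ∈ strip T, IsHInf (u t)
  normCont : ∀ n : ℕ, ContinuousOn (fun t => hn n (u t)) (strip T)
  eq : ∀ t ∈ strip T, ∀ x,
    timeDerivWithin (strip T) u t x + lerayProj (convect (Jmol γ (u t)) (u t)) x = Δ (u t) x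
  divFree : ∀ t ∈ strip T, NSWave0.IsDivFree (u t)
  init : u 0 = u₀

/-- The blow-up time `T_bup^γ(u_o)`: the supremum of the `T` carrying a solution of (7.1)_{γ,u_o} on
`[0,T)` (T6.2 p. 63: «The strip … contains every strip `ℝ³ × [0,T]` on which there is a solution»;
T8.2 p. 105). [cite: Jennings2020, T6.2 p.63, T8.2 p.105] -/
noncomputable def Tbup (γ : ℝ) (u₀ : E3 → E3) : ℝ≥0∞ := sSup {T : ℝ≥0∞ | ∃ u, MolSol γ u₀ T u}

/-- The pressure of §10/§11 (p. 8 and §10): `p := (−4π)⁻¹ ∫ Σ_{i,j} ∂ᵢ|z|⁻¹ (u_j ∂ⱼ u_i)(x−z,t) dz`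
= `(−4π)⁻¹ ∫ ⟨∇|z|⁻¹, ((u·∇)u)(x−z,t)⟩ dz`. [cite: Jennings2020, §1 p.8, §10 p.116] -/
noncomputable def pOf (u : ℝ → E3 → E3) (t : ℝ) (x : E3) : ℝ :=
  (-4 * Real.pi)⁻¹ *
    ∫ z, @inner ℝ E3 _ (gradient (fun y : E3 => ‖y‖⁻¹) z) (convect (u t) (u t) (x - z))

/-- The `ν`-rescaling (11.1) p. 131: `u^ν(x,t) := u^{ν=1}(xν⁻¹, tν⁻¹; u_o(xν))`,
`p^ν(x,t) := p^{ν=1}(xν⁻¹, tν⁻¹; u_o(xν))`. [cite: Jennings2020, (11.1) p.131] -/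
noncomputable def rescale {F : Type*} (ν : ℝ) (U : ℝ → E3 → F) : ℝ → E3 → F := fun t x => U (t / ν) (ν⁻¹ • x)

/-! ## The claimed theorem -/

/-- The paper's spec in the reference file's format: data `∩_m H^m` (div-free and `C^∞` are schema
hypotheses), admissible = the printed conclusions of T11.1 beyond smoothness: `u(t), p(t) ∈ ∩_m H^m` for
`t ≥ 0`, and the two sup-identities (11.2), rendered exactly as «for all `t ≥ 0`,
`|u(t)|_{L^∞} ≤ |u(0)|_{L^∞}` and `|u(t)|²_{L²} ≤ |u(0)|²_{L²}`» (a supremum over `[0,∞) ∋ 0` equals the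
value at `0` iff every value is below it). The continuity-in-`t` clause of `H^m × [0,∞)` is not repeated
(omitting it weakens the typed claim). The force slot is unused by `Regularity` (set to `f = 0`).
[cite: Jennings2020, T11.1 (11.2) p.131] -/
def jenningsSpec : ClayVariants.ClaySpec where
  data := fun u₀ => IsHInf u₀
  force := fun f => f = 0
  admissible := fun u p =>
    (∀ t : ℝ, 0 ≤ t → IsHInf (u t) ∧ IsHInf (p t)) ∧
    (∀ t : ℝ, 0 ≤ t → linf (u t) ≤ linf (u 0)) ∧
    (∀ t : ℝ, 0 ≤ t → l2sq (u t) ≤ l2sq (u 0))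

/-- THE CLAIMED THEOREM (T11.1 p. 131 with §1 p. 1–2 and p. 8/p. 133 «a solution of Option A»): for
every `ν > 0` and every `C^∞` divergence-free `u_o ∈ ∩_m H^m(ℝ³)` there are `u, p ∈ C^∞(ℝ³ × [0,∞))`
solving (1.1)_{ν,u_o} with `u(0) = u_o`, in the classes above, with the sup-identities (11.2). A `def`,
never a `theorem`. [cite: Jennings2020, T11.1 p.131, §1 p.1–2] -/
def ClaimedTheorem : Prop := jenningsSpec.Regularity

/-- `|u|_{L^∞×[0,t]} := sup_{η∈[0,t]} |u(η)|_{L^∞}` (p. 3). [cite: Jennings2020, §1 p.3] -/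
noncomputable def supLinf (u : ℝ → E3 → E3) (t : ℝ) : ℝ≥0∞ := ⨆ s ∈ Icc (0 : ℝ) t, linf (u s)

/-! ## Steps, in the order of the printed proof -/

/-- **Step 1 — dilated data stay in the class (p. 109 l.7280–7283; (11.1) p. 131):** «we let (9.3)
`u_o^α(x) := α u_o(xα)` which the chain rule shows is `∈ ∩_m H^{m,df}`»; likewise `u_o(xν)` in §11.
[cite: Jennings2020, (9.3) p.109, (11.1) p.131] -/
def Step1_DataDilation : Prop :=
  ∀ c a : ℝ, a ≠ 0 → ∀ u₀ : E3 → E3, InData u₀ → InData (dilData c a u₀)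

/-- **Step 2 — local existence (T6.2 p. 63, T7.1 p. 75, T8.2 (8.18) p. 105):** for `γ ≥ 0` and
`u_o ∈ ∩_m H^{m,df}` there is a solution `u^γ(x,t;u_o) ∈ ∩_m[H^{m,df} × [0,T_bup^γ(u_o))]` of the
(6.1) integral equation (T6.2), hence of the (7.1) pde with `∂ₜu` in the same space (T7.1, T8.2), and
`T_bup^γ(u_o) ≥ […]_{6.19}|u_o|_{H^7}^{−2} > 0` (the constant is not typed).
[cite: Jennings2020, T6.2 (6.19) p.63, T7.1 p.75, T8.2 (8.18) p.105] -/
def Step2_LocalExistence : Prop :=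
  ∀ γ : ℝ, 0 ≤ γ → ∀ u₀ : E3 → E3, InData u₀ → 0 < Tbup γ u₀ ∧ ∃ u, MolSol γ u₀ (Tbup γ u₀) u

/-- **Step 3 — uniqueness (L7.3 p. 86):** «When `T` is `> 0`, there is at most one function
`u ∈ H^{7,df} × [0,T]` the derivative `∂ₜu` of which is `∈ H^{5,df} × [0,T]` which satisfies the
(7.1)_{k'=0,γ,u_o} pde … on `ℝ³ × [0,T]`» (typed in the narrower class `MolSol`).
[cite: Jennings2020, L7.3 p.86] -/
def Step3_Uniqueness : Prop :=
  ∀ γ : ℝ, 0 ≤ γ → ∀ (u₀ : E3 → E3) (T : ℝ≥0∞) (u v : ℝ → E3 → E3),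
    MolSol γ u₀ T u → MolSol γ u₀ T v → ∀ t ∈ strip T, u t = v t

/-- **Step 4 — `L²` identity and `L^∞` blow-up criterion (T7.7 (1.5)/(7.51) p. 95; T8.1 (8.1) p. 98,
T8.2 (8.21) p. 105):** «`|u^{γ,m}|_{L²×[0,T_bup^{γ,m}(u_o))} = |u_o|_{L²}`» (i.e. `|u(t)|_{L²} ≤ |u_o|_{L²}`
for every `t`, the supremum being attained at `t = 0`) and «`|u^γ|_{L^∞×[0,T]} → ∞` as `T →` a finite
`T_bup^γ(u_o)`». [cite: Jennings2020, T7.7 (1.5) p.95, T8.1 (8.1) p.98, T8.2 (8.21) p.105] -/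
def Step4_L2_Blowup : Prop :=
  ∀ γ : ℝ, 0 ≤ γ → ∀ u₀ : E3 → E3, InData u₀ → ∀ (T : ℝ≥0∞) (u : ℝ → E3 → E3), MolSol γ u₀ T u →
    (∀ t ∈ strip T, l2sq (u t) ≤ l2sq u₀) ∧
    (T = Tbup γ u₀ → T < ⊤ → ∀ M : ℝ≥0∞, M < ⊤ → ∃ t ∈ strip T, M < linf (u t))

/-- **Step 5 — the case `γ > 0` (T8.2 (8.19), (8.22) p. 105; proof (8.23)–(8.29) p. 105–108):**
«`T_bup^{γ>0}(u_o)` is `= ∞`» and «(8.22) `|u^{γ>0}(·;u_o)|_{L^∞×[0,t]} ≤ […]_{8.28}(|m†_γ|_{L²}) t^{1/2}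
|u_o|_{L²} |u^{γ>0}(·;u_o)|_{L^∞×[0,t]} + |u_o|_{L^∞}`» (constant depending on `γ` and `m†` only).
[cite: Jennings2020, T8.2 (8.19) (8.22) p.105] -/
def Step5_T82_gammaPos : Prop :=
  ∀ γ : ℝ, 0 < γ → ∃ C : ℝ, 0 ≤ C ∧ ∀ u₀ : E3 → E3, InData u₀ →
    Tbup γ u₀ = ⊤ ∧ ∀ u : ℝ → E3 → E3, MolSol γ u₀ ⊤ u → ∀ t : ℝ, 0 ≤ t →
      supLinf u t ≤ ENNReal.ofReal (C * Real.sqrt t) * l2sq u₀ ^ (1 / 2 : ℝ) * supLinf u t + linf u₀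

/-- **Step 6 — the SCALING RULE, Lemma 9.1 (9.4) p. 109, AS PRINTED (u-level):** «Let `u_o` be
`∈ ∩_m H^{m,df}`, `α` be `> 0` and `γ` be `≥ 0`. Then (9.4) `u^γ(x,t;u_o^α) = α u^γ(xα,tα²;u_o)` on
`ℝ³ × [0,∞)`» (for `γ = 0`: «on `ℝ³ × [0,T_bup^{γ=0}(u_o) α⁻²)`», p. 110), `u_o^α(x) := α u_o(xα)`; the
proof's content (p. 109–110): «`α u^{γ>0}(xα,tα²;u_o)` satisfies the (7.1)_{k'=0,γ>0,u_o^α} pde», then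
L7.3. NOTE: the mollification scale `γ` is held FIXED under the dilation `x ↦ xα` (the covariance of
(7.1) that does hold maps `γ` to `γ/α`); see `Step6b_JDilation` for the operator-level identity the
displayed computation (9.5)–(9.7) uses. Typed: the dilate of ANY solution from `u_o` on `[0,T)` is a
solution from `u_o^α` on `[0,T/α²)`, same `γ`. [cite: Jennings2020, L9.1 (9.4)–(9.7) p.109–110] -/
def Step6_ScalingRule : Prop :=
  ∀ γ : ℝ, 0 ≤ γ → ∀ α : ℝ, 0 < α → ∀ u₀ : E3 → E3, InData u₀ →
    ∀ (T : ℝ≥0∞) (u : ℝ → E3 → E3), MolSol γ u₀ T u →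
      MolSol γ (dilData α α u₀) (T / ENNReal.ofReal (α ^ 2)) (dilSol α u)

/-- **Step 6b — the `J_{γ>0}`-term of (9.5)–(9.7), p. 110 (operator level; the grain at which the
display argues).** (9.5) contains `J_{γ>0}[α u_j^{γ>0}(xα,tα²;u_o)]` (the mollifier applied to the
DILATED component); «The chain rule then shows» (9.6) with `α J_{γ>0}[u_j^{γ>0}(xα,tα²;u_o)]`, and
«(4.14) shows that (9.6) is =» (9.7) `[… P_l[Σⱼ [J_{γ>0}[u_j^{γ>0}(·;u_o)] ∂ⱼu^{γ>0}(·;u_o)](tα²)](xα) …]α³`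
(the mollifier applied to the UNDILATED component, then evaluated at `xα`). The identity thereby used,
for the fixed-scale mollifier `J_γ` (`m†_γ(y) = γ⁻³m†(y/γ)`, p. 6) and a dilation `x ↦ xα`:
`J_γ[x ↦ α v(xα)] = x ↦ α (J_γ v)(xα)`, for fields `v` of the class of `u^γ(t)` (`C^∞ ∩ ∩_m H^m`).
No cited equation of the passage ((2.20), (2.22), (4.14), «the chain rule») concerns `J_{γ>0}` under
dilation (lit-2 LOCATORS S4). [cite: Jennings2020, (9.5)–(9.7) p.110] -/
def Step6b_JDilation : Prop :=
  ∀ γ : ℝ, 0 < γ → ∀ α : ℝ, 0 < α → ∀ v : E3 → E3, ContDiff ℝ (⊤ : ℕ∞) v → IsHInf v →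
    Jmol γ (fun x => α • v (α • x)) = fun x => α • Jmol γ v (α • x)

/-- **Step 6c — the `P_l`-term of (9.6) → (9.7), p. 110:** «As (2.20), (2.22) and the chain rule show that
the argument of `P_l` in (9.6) is `∈ ∩_m[H^m ∩ W^{m,1}]`, (4.14) shows that (9.6) is = (9.7)»: the
dilation covariance of the Helmholtz–Hodge projector, `P_l[x ↦ w(xα)] = x ↦ (P_l w)(xα)` on
`C^∞ ∩ ∩_m[H^m ∩ W^{m,1}]` (a degree-zero operator; true — typed for completeness of the passage).
[cite: Jennings2020, (9.6)–(9.7) p.110, (4.14) p.36] -/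
def Step6c_PlDilation : Prop :=
  ∀ α : ℝ, 0 < α → ∀ w : E3 → E3, ContDiff ℝ (⊤ : ℕ∞) w → IsHInf w →
    (∀ n : ℕ, Integrable (fun x => iteratedFDeriv ℝ n w x)) →
      lerayProj (fun x => w (α • x)) = fun x => lerayProj w (α • x)

/-- **Step 7 — (9.11), Theorem 9.2 proof step 1, p. 111–112 (the decisive `L^∞` bound):** «With `α` and
`γ > 0` and `t ≥ 0`, (8.22) shows that `|u^{γ>0}(x,tα⁻²;u_o^α)| ≤ […]_{8.28} [tα⁻²]^{1/2} |u_o^α|_{L²}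
|u^{γ>0}(η;u_o^α)|_{L^∞×[0,tα⁻²]} + |u_o^α|_{L^∞}` which with the (9.4) scaling rule, (9.9) (second line)
and (9.8) shows that … `|u^{γ>0}(t;u_o)|_{L^∞} ≤ […] t^{1/2} α^{−3/2} |u^{γ>0}(·;u_o)|_{L^∞×[0,t]} +
|u_o|_{L^∞}` … passage to the limit as `α → ∞` with `[…]` and `t` fixed shows that
`|u^{γ>0}(·;u_o)|_{L^∞×[0,∞)} ≤ |u_o|_{L^∞}` and … (9.11) `|u^{γ>0}(·;u_o)|_{L^∞×[0,∞)} = |u_o|_{L^∞}`.»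
Typed: the inequality for every `t ≥ 0`, every `γ > 0`, every datum of the class and every global
solution of (7.1)_{γ,u_o}. [cite: Jennings2020, T9.2 (9.11) p.111–112] -/
def Step7_SupBound_911 : Prop :=
  ∀ γ : ℝ, 0 < γ → ∀ u₀ : E3 → E3, InData u₀ → ∀ u : ℝ → E3 → E3, MolSol γ u₀ ⊤ u →
    ∀ t : ℝ, 0 ≤ t → linf (u t) ≤ linf u₀

/-- **Step 8 — `γ → 0⁺`, Theorem 9.2 proof step 2, p. 112–115 ((9.12)–(9.13)) and T9.2 (9.10) at
`γ = 0`:** «We now extend the (9.11) inequality to `u^{γ=0}(x,t;u_o)`»: equicontinuity of the `u^{γ>0}`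
from (8.2)/(8.3) + (9.11), Arzelà–Ascoli on each `Ω_N`, Cantor diagonalisation, dominated convergence
(«`u*` satisfies the (6.1)_{γ=0} integral equation»), L7.3 uniqueness `u^{γ=0} = u*`, hence
`|u^{γ=0}|_{L^∞×[0,T_bup^{γ=0})} ≤ |u_o|_{L^∞}` «which with the (1.7) blow up condition shows that
`u^{γ=0}` is a global-in-time solution». Typed as the printed implication FROM (9.11) (`Step7`'s
statement) TO `T_bup^{γ=0}(u_o) = ∞` and the bound for `γ = 0`.
[cite: Jennings2020, T9.2 (9.10) (9.12)–(9.13) p.111–115] -/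
def Step8_GammaZero : Prop :=
  Step7_SupBound_911 →
    ∀ u₀ : E3 → E3, InData u₀ →
      Tbup 0 u₀ = ⊤ ∧ ∀ (T : ℝ≥0∞) (u : ℝ → E3 → E3), MolSol 0 u₀ T u →
        ∀ t ∈ strip T, linf (u t) ≤ linf u₀

/-- **Step 9 — smoothness and the pressure (§10 L10.1–L10.4 p. 116–130; §11 p. 131 first part):**
«`u^{γ=0}` and `p^{γ=0} := (−4π)⁻¹ ∫ Σ_{i,j} ∂ᵢ|z|⁻¹ u_j^{γ=0}∂ⱼu_i^{γ=0}(x−z,t) dz` are `∈ C^∞` and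
`∈ ∩_m[H^m × [0,∞)]`» and «`u^{γ=0}` and `p^{γ=0}` satisfy the (1.1)_{ν=1,u_o} pde on `ℝ³ × [0,∞)`»
(tree notion `IsNavierStokesSolution 1 0 u_o`). [cite: Jennings2020, §10 L10.1–L10.4 p.116–130, §11 p.131] -/
def Step9_Smooth : Prop :=
  ∀ u₀ : E3 → E3, InData u₀ → ∀ u : ℝ → E3 → E3, MolSol 0 u₀ ⊤ u →
    IsSmoothOnHalfSpace u ∧ IsSmoothOnHalfSpace (pOf u) ∧ (∀ t : ℝ, 0 ≤ t → IsHInf (pOf u t)) ∧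
      IsNavierStokesSolution 1 (0 : ℝ → E3 → E3) u₀ u (pOf u)

/-- **Step 10 — the `ν`-rescaling, Theorem 11.1 (11.1)–(11.2) p. 131–133:** «the functions (11.1)
`u^ν(x,t;u_o) := u^{ν=1}(xν⁻¹,tν⁻¹;u_o(xν))` and `p^ν(x,t;u_o) := p^{ν=1}(xν⁻¹,tν⁻¹;u_o(xν))` in which
`ν` is `> 0` are a `C^∞` solution of the (1.1)_{ν,u_o} equations on `ℝ³ × [0,∞)`, … `u^ν ∈ ∩_m[H^{m,df}
× [0,∞)]`, … `p^ν ∈ ∩_m[H^m × [0,∞)]`, and … (11.2)». Typed as the implication from the `ν = 1`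
objects for the datum `u_o(xν)` (global solution of (7.1)_{γ=0}, smooth, with pressure `pOf`, solving
(1.1)_{ν=1}, with the (9.13)/(1.5) bounds) to the conclusion for `(ν, u_o)` in the format of
`jenningsSpec`. [cite: Jennings2020, T11.1 (11.1)–(11.2) p.131–133] -/
def Step10_NuRescaling : Prop :=
  ∀ ν : ℝ, 0 < ν → ∀ u₀ : E3 → E3, InData u₀ → ∀ U : ℝ → E3 → E3,
    MolSol 0 (dilData 1 ν u₀) ⊤ U → IsSmoothOnHalfSpace U → IsSmoothOnHalfSpace (pOf U) →
    (∀ t : ℝ, 0 ≤ t → IsHInf (pOf U t)) →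
    IsNavierStokesSolution 1 (0 : ℝ → E3 → E3) (dilData 1 ν u₀) U (pOf U) →
    (∀ t : ℝ, 0 ≤ t → linf (U t) ≤ linf (dilData 1 ν u₀)) →
    (∀ t : ℝ, 0 ≤ t → l2sq (U t) ≤ l2sq (dilData 1 ν u₀)) →
      IsSmoothOnHalfSpace (rescale ν U) ∧ IsSmoothOnHalfSpace (rescale ν (pOf U)) ∧
        IsNavierStokesSolution ν (0 : ℝ → E3 → E3) u₀ (rescale ν U) (rescale ν (pOf U)) ∧
        jenningsSpec.admissible (rescale ν U) (rescale ν (pOf U))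

/-! ## Composition and Clay link -/

/-- COMPOSITION (PROVED), in the paper's own logic and order: given `ν > 0` and a `C^∞` div-free datum
`u_o ∈ ∩_m H^m`, the datum `u_o(xν)` is in the class (Step 1); the maximal solution of (7.1)_{γ=0} from
it exists (Step 2); by Step 8 — fed with (9.11) = Step 7 — it is global and `L^∞`-bounded by the datum;
Step 4 gives the `L²` bound; Step 9 smoothness, pressure and the `ν = 1` equations; Step 10 rescales to
`ν`. Steps 3, 5, 6, 6b, 6c are the printed inputs of Steps 7 and 8 and are carried as hypotheses.
[cite: Jennings2020, T9.2 p.111–115, T11.1 p.131–133] -/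
theorem claim_of_steps (h1 : Step1_DataDilation) (h2 : Step2_LocalExistence) (_h3 : Step3_Uniqueness)
    (h4 : Step4_L2_Blowup) (_h5 : Step5_T82_gammaPos) (_h6 : Step6_ScalingRule)
    (_h6b : Step6b_JDilation) (_h6c : Step6c_PlDilation) (h7 : Step7_SupBound_911)
    (h8 : Step8_GammaZero) (h9 : Step9_Smooth) (h10 : Step10_NuRescaling) : ClaimedTheorem := by
  intro ν hν u₀ hu₀ hdiv hdata
  have hw₀ : InData (dilData 1 ν u₀) := h1 1 ν hν.ne' u₀ ⟨hu₀, hdata, hdiv⟩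
  obtain ⟨hT, hbound⟩ := h8 h7 (dilData 1 ν u₀) hw₀
  obtain ⟨_, U, hU⟩ := h2 0 le_rfl (dilData 1 ν u₀) hw₀
  rw [hT] at hU
  obtain ⟨hUs, hPs, hPH, hNS⟩ := h9 _ hw₀ U hU
  have hlinf : ∀ t : ℝ, 0 ≤ t → linf (U t) ≤ linf (dilData 1 ν u₀) :=
    fun t ht => hbound ⊤ U hU t ⟨ht, ENNReal.ofReal_lt_top⟩
  have hl2 : ∀ t : ℝ, 0 ≤ t → l2sq (U t) ≤ l2sq (dilData 1 ν u₀) :=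
    fun t ht => (h4 0 le_rfl _ hw₀ ⊤ U hU).1 t ⟨ht, ENNReal.ofReal_lt_top⟩
  obtain ⟨hs, hps, hns, hadm⟩ := h10 ν hν u₀ ⟨hu₀, hdata, hdiv⟩ U hU hUs hPs hPH hNS hlinf hl2
  exact ⟨rescale ν U, rescale ν (pOf U), hs, hps, hns, hadm⟩

/-- CLAY LINK (PROVED): the claimed theorem implies Fefferman's (A) (`ClayVariants.clayR3.Regularity`;
summit-side `clayR3.Regularity ↔ NavierStokesRegularity`): Clay's (4)-data have all derivatives in `L²`
(`HasRapidSpatialDecay.lintegral_enorm_iteratedFDeriv_sq_lt_top`), and the printed `L²` identity gives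
the bounded energy (7) with the constant `|u(0)|²_{L²} < ∞` (`u(0) ∈ H⁰`). So the typed claim is on the
STRONGER side of (A) along the data axis and equal on the others — no wrong-problem axis.
[cite: Jennings2020, §11 closing paragraph p.133] -/
theorem clay_of_claimed (h : ClaimedTheorem) : ClayVariants.clayR3.Regularity := by
  refine ClayVariants.ClaySpec.Regularity.mono (S := jenningsSpec) (T := ClayVariants.clayR3)
    (fun u₀ hd n => HasRapidSpatialDecay.lintegral_enorm_iteratedFDeriv_sq_lt_top hd n) ?_ h
  intro u p hadm
  have h0 : ∫⁻ x, ‖iteratedFDeriv ℝ 0 (u 0) x‖ₑ ^ 2 < ⊤ := (hadm.1 0 le_rfl).1 0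
  have hfun : (fun x => ‖iteratedFDeriv ℝ 0 (u 0) x‖ₑ ^ 2) = fun x => ‖u 0 x‖ₑ ^ 2 := by
    funext x
    rw [← ofReal_norm, norm_iteratedFDeriv_zero, ofReal_norm]
  refine ⟨l2sq (u 0), ?_, fun t ht => hadm.2.2 t ht⟩
  unfold l2sq
  rw [← hfun]
  exact h0

/-! ## Kernel certificate for Step 6c — dilation covariance of `P_l` (APPEND-ONLY, 2026-08-27)

`theorem step6c_PlDilation_holds : Step6c_PlDilation`. With this file's `lerayProj v = v − ∇N(div v)`
(`N` the Newtonian potential) the identity `P_l[x ↦ w(xα)] = x ↦ (P_l w)(xα)` (`α > 0`) is elementary: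
`div(w∘(α•)) = α·(div w)∘(α•)` (trace of the Fréchet derivative; chain rule, with the junk case),
`N(α·d∘(α•)) = α⁻¹·(N d)∘(α•)` (Haar scaling of Lebesgue measure on `ℝ³`, Mathlib
`Measure.integral_comp_smul`, and `‖x − α⁻¹z‖ = α⁻¹‖αx − z‖`), and `∇(α⁻¹·G∘(α•)) = (∇G)∘(α•)`.
No hypothesis on `w` beyond those of the Step is used (the identity holds for every field). This Step was
flagged «true — typed for completeness» (p.110); it is not the adjudicated locator of C20 and nothing in
the verdict / locator / class / statements changes. FIRST KERNEL PROOF (Summits side, not importable from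
`Literature/`): `Summit.NavierStokesRegularity.NavierStokesRegularity.Theorems.Jennings2020.step6c_holds`
(`Theorems/SoloSalvageJennings2020.lean`, seat ns-claims-salvage-p2, p479038; same route) — this in-file
copy exists only so that the Literature-side fact `Step6c_PlDilation` carries its `_holds` (D-0026 census). -/

section Step6cCertificate

/-- Chain rule for `y ↦ f (α • y)` with the junk case: `D(f∘(α•))(x) = α • Df(αx)` for `α ≠ 0`
(both sides are `0` where `f` is not differentiable at `αx`). (Proof device.) [folklore] -/
private theorem fderiv_comp_smul {F : Type*} [NormedAddCommGroup F] [NormedSpace ℝ F]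
    (f : E3 → F) {α : ℝ} (hα : α ≠ 0) (x : E3) :
    fderiv ℝ (fun y => f (α • y)) x = α • fderiv ℝ f (α • x) := by
  by_cases hf : DifferentiableAt ℝ f (α • x)
  · have hg : HasFDerivAt (fun y : E3 => α • y) (α • ContinuousLinearMap.id ℝ E3) x :=
      (hasFDerivAt_id x).const_smul α
    have hc : HasFDerivAt (fun y => f (α • y))
        ((fderiv ℝ f (α • x)).comp (α • ContinuousLinearMap.id ℝ E3)) x :=
      hf.hasFDerivAt.comp x hg
    rw [hc.fderiv]
    ext v
    simp
  · have hnd : ¬ DifferentiableAt ℝ (fun y => f (α • y)) x := by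
      intro h
      apply hf
      have hx : α⁻¹ • (α • x) = x := by rw [smul_smul, inv_mul_cancel₀ hα, one_smul]
      have h1 : DifferentiableAt ℝ (fun y => f (α • y)) (α⁻¹ • (α • x)) := by rw [hx]; exact h
      have hk : DifferentiableAt ℝ (fun z : E3 => α⁻¹ • z) (α • x) :=
        ((hasFDerivAt_id (α • x)).const_smul α⁻¹).differentiableAt
      have h2 : DifferentiableAt ℝ ((fun y => f (α • y)) ∘ fun z : E3 => α⁻¹ • z) (α • x) :=
        h1.comp (α • x) hk
      refine h2.congr_of_eventuallyEq (Filter.Eventually.of_forall fun z => ?_)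
      show f z = ((fun y => f (α • y)) ∘ fun z : E3 => α⁻¹ • z) z
      simp only [Function.comp_apply, smul_smul, mul_inv_cancel₀ hα, one_smul]
    rw [fderiv_zero_of_not_differentiableAt hf, fderiv_zero_of_not_differentiableAt hnd, smul_zero]

/-- `div (w∘(α•)) = α · (div w)∘(α•)` (`α ≠ 0`; trace of the derivative). (Proof device.) [folklore] -/
private theorem divergence_comp_smul (w : E3 → E3) {α : ℝ} (hα : α ≠ 0) (x : E3) :
    VectorCalculus.divergence (fun y => w (α • y)) x = α * VectorCalculus.divergence w (α • x) := by
  unfold VectorCalculus.divergence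
  rw [fderiv_comp_smul w hα x, ContinuousLinearMap.toLinearMap_smul, map_smul, smul_eq_mul]

/-- Scaling of the Newtonian potential: `N(α · d∘(α•))(x) = α⁻¹ · (N d)(αx)` for `α > 0` (Haar scaling
`∫ f(αy) dy = α⁻³ ∫ f`, and `‖x − α⁻¹z‖ = α⁻¹‖αx − z‖`). (Proof device.) [folklore] -/
private theorem newton_comp_smul (d : E3 → ℝ) {α : ℝ} (hα : 0 < α) (x : E3) :
    newton (fun y => α * d (α • y)) x = α⁻¹ * newton d (α • x) := by
  have hα0 : α ≠ 0 := hα.ne'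
  unfold newton
  have hfun : (fun y : E3 => -(4 * Real.pi * ‖x - y‖)⁻¹ * (α * d (α • y))) =
      fun y : E3 => (fun z : E3 => -(4 * Real.pi * ‖x - α⁻¹ • z‖)⁻¹ * (α * d z)) (α • y) := by
    funext y
    simp only [smul_smul, inv_mul_cancel₀ hα0, one_smul]
  rw [hfun, Measure.integral_comp_smul (μ := (volume : Measure E3))
    (fun z : E3 => -(4 * Real.pi * ‖x - α⁻¹ • z‖)⁻¹ * (α * d z)) α]
  have hpt : ∀ z : E3, -(4 * Real.pi * ‖x - α⁻¹ • z‖)⁻¹ * (α * d z) =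
      α ^ 2 * (-(4 * Real.pi * ‖α • x - z‖)⁻¹ * d z) := by
    intro z
    have hn : ‖x - α⁻¹ • z‖ = α⁻¹ * ‖α • x - z‖ := by
      rw [show x - α⁻¹ • z = α⁻¹ • (α • x - z) by
        rw [smul_sub, smul_smul, inv_mul_cancel₀ hα0, one_smul], norm_smul, Real.norm_eq_abs,
        abs_of_pos (inv_pos.2 hα)]
    rw [hn, show 4 * Real.pi * (α⁻¹ * ‖α • x - z‖) = α⁻¹ * (4 * Real.pi * ‖α • x - z‖) by ring,
      mul_inv, inv_inv]
    ring
  simp_rw [hpt]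
  rw [integral_const_mul, finrank_euclideanSpace_fin, smul_eq_mul,
    abs_of_pos (inv_pos.2 (pow_pos hα 3))]
  field_simp

/-- `∇(x ↦ α⁻¹ G(αx)) = (∇G)∘(α•)` for `α ≠ 0` (junk cases included). (Proof device.) [folklore] -/
private theorem gradient_inv_mul_comp_smul (G : E3 → ℝ) {α : ℝ} (hα : α ≠ 0) (x : E3) :
    gradient (fun y => α⁻¹ * G (α • y)) x = gradient G (α • x) := by
  unfold gradient
  have hfun : (fun y : E3 => α⁻¹ * G (α • y)) = α⁻¹ • (fun y : E3 => G (α • y)) := by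
    funext y; simp [smul_eq_mul]
  rw [hfun, fderiv_const_smul_field, Pi.smul_apply, fderiv_comp_smul G hα x, smul_smul,
    inv_mul_cancel₀ hα, one_smul]

/-- **Step 6c is a THEOREM**: for `α > 0` and every field `w`, `P_l[x ↦ w(xα)] = x ↦ (P_l w)(xα)` for the
Helmholtz–Hodge projector `P_l v = v − ∇N(div v)` of §4 p.34–35, as invoked at (9.6)→(9.7) p.110
(«(4.14) shows»). Kernel certificate of a step the skeleton flags «true — typed for completeness»; no
verdict / locator / class touched. Literature-side twin of the Summits-side
`Summit.NavierStokesRegularity.NavierStokesRegularity.Theorems.Jennings2020.step6c_holds` (p479038).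
[cite: Jennings2020, (9.6)–(9.7) p.110, (4.14) p.36] -/
theorem step6c_PlDilation_holds : Step6c_PlDilation := by
  intro α hα w _ _ _
  have hα0 : α ≠ 0 := hα.ne'
  funext x
  unfold lerayProj
  have hdiv : VectorCalculus.divergence (fun y => w (α • y)) =
      fun y => α * VectorCalculus.divergence w (α • y) :=
    funext fun y => divergence_comp_smul w hα0 y
  have hN : newton (fun y => α * VectorCalculus.divergence w (α • y)) =
      fun y => α⁻¹ * newton (VectorCalculus.divergence w) (α • y) :=
    funext fun y => newton_comp_smul _ hα y
  rw [hdiv, hN, gradient_inv_mul_comp_smul _ hα0]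

end Step6cCertificate

/-! ## Kernel certificate for Step 1 (data-class dilation invariance, (9.3) p.109 / (11.1) p.131)

The data class `∩_m H^{m,df}` (`C^∞`, every derivative in `L²`, divergence free) is invariant under
`u₀ ↦ c • u₀(a •)`, `a ≠ 0` — the chain rule, as the paper says («(9.3) … is again in `∩_m H^{m,df}`»).
This Step was flagged «true» at typing; it is not the adjudicated locator of C20 and nothing in the
verdict / locator / class / statements changes. FIRST KERNEL PROOF (Summits side, not importable from
`Literature/`): `Summit.NavierStokesRegularity.NavierStokesRegularity.Theorems.Jennings2020.step1_holds`
(`Theorems/SoloSalvageJennings2020.lean`, seat ns-claims-salvage-p2, p479038) — this in-file copy exists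
only so that the Literature-side fact `Step1_DataDilation` carries its `_holds` (D-0026 census); the
homothety chain rule in norm is inlined (as in `Literature.Claims.NS.Chadwick2023`) to keep the import
cone of this skeleton unchanged. -/

section Step1Certificate

/-- Haar change of variables on `ℝ³` for lower integrals: `∫⁻ g(a • x) dx = |(a³)⁻¹| ∫⁻ g` for `a ≠ 0`
(Mathlib `Measure.map_addHaar_smul`). (Proof device.) [folklore] -/
private theorem lintegral_comp_smul_R3 (g : E3 → ℝ≥0∞) {a : ℝ} (ha : a ≠ 0) :
    ∫⁻ x, g (a • x) = ENNReal.ofReal |(a ^ Module.finrank ℝ E3)⁻¹| * ∫⁻ x, g x := by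
  calc ∫⁻ x, g (a • x) = ∫⁻ y, g y ∂(Measure.map (a • ·) volume) :=
        (lintegral_map_equiv g (Homeomorph.smul (isUnit_iff_ne_zero.2 ha).unit).toMeasurableEquiv).symm
    _ = ENNReal.ofReal |(a ^ Module.finrank ℝ E3)⁻¹| * ∫⁻ x, g x := by
        rw [Measure.map_addHaar_smul volume ha, lintegral_smul_measure, smul_eq_mul]

/-- Chain rule for a homothety, in norm: `‖Dᵏ[ψ(b ·)](x)‖ ≤ |b|ᵏ ‖Dᵏψ(bx)‖` (`b ≠ 0`), no
differentiability hypothesis; the proof of the tree's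
`Literature.Analysis.FluidPDE.norm_iteratedFDeriv_comp_smul_le` (KNSSLocalSmoothingHolds), inlined.
(Proof device.) [folklore] -/
private theorem norm_iteratedFDeriv_comp_smul_le {F : Type*} [NormedAddCommGroup F] [NormedSpace ℝ F]
    (ψ : E3 → F) {b : ℝ} (hb : b ≠ 0) (k : ℕ) (x : E3) :
    ‖iteratedFDeriv ℝ k (fun y => ψ (b • y)) x‖ ≤ |b| ^ k * ‖iteratedFDeriv ℝ k ψ (b • x)‖ := by
  set e : E3 ≃L[ℝ] E3 :=
    ContinuousLinearEquiv.equivOfInverse (b • ContinuousLinearMap.id ℝ E3)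
      (b⁻¹ • ContinuousLinearMap.id ℝ E3) (fun y => by simp [smul_smul, hb])
      (fun y => by simp [smul_smul, hb]) with he
  have hee : ∀ y, e y = b • y := fun y => rfl
  have hcomp : (fun y => ψ (b • y)) = ψ ∘ e := rfl
  have h := e.iteratedFDerivWithin_comp_right ψ uniqueDiffOn_univ (mem_univ (e x)) k
  simp only [preimage_univ, iteratedFDerivWithin_univ] at h
  rw [hcomp, h, hee x, mul_comm]
  refine (ContinuousMultilinearMap.norm_compContinuousLinearMap_le _ _).trans ?_
  rw [Finset.prod_const, Finset.card_univ, Fintype.card_fin]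
  refine mul_le_mul_of_nonneg_left (pow_le_pow_left₀ (norm_nonneg _) ?_ k) (norm_nonneg _)
  refine ContinuousLinearMap.opNorm_le_bound _ (abs_nonneg b) fun y => ?_
  rw [ContinuousLinearEquiv.coe_coe, hee y, norm_smul, Real.norm_eq_abs]

/-- **Step 1 is a THEOREM ((9.3) p.109, (11.1) p.131)**: the data class `∩_m H^{m,df}` (`C^∞`, every
derivative in `L²`, divergence free) is invariant under `u₀ ↦ c • u₀(a •)`, `a ≠ 0` — the chain rule, as
the paper says. Kernel certificate of a step the skeleton flags «true»; no verdict / locator / class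
touched. Literature-side twin of the Summits-side
`Summit.NavierStokesRegularity.NavierStokesRegularity.Theorems.Jennings2020.step1_holds` (p479038).
[cite: Jennings2020, (9.3) p.109, (11.1) p.131] -/
theorem step1_DataDilation_holds : Step1_DataDilation := by
  intro c a ha u₀ hu
  obtain ⟨hsmooth, hH, hdiv⟩ := hu
  -- smoothness
  have hcomp : ContDiff ℝ (⊤ : ℕ∞) (fun x : E3 => u₀ (a • x)) := hsmooth.comp (contDiff_id.const_smul a)
  have hsmooth' : ContDiff ℝ (⊤ : ℕ∞) (dilData c a u₀) := hcomp.const_smul c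
  refine ⟨hsmooth', ?_, ?_⟩
  · -- every derivative in `L²`
    intro n
    have hcompn : ContDiff ℝ n (fun x : E3 => u₀ (a • x)) := hcomp.of_le (by exact_mod_cast le_top)
    -- pointwise bound on the iterated derivative
    have hpt : ∀ x : E3, ‖iteratedFDeriv ℝ n (dilData c a u₀) x‖ₑ ≤
        ENNReal.ofReal (|c| * |a| ^ n) * ‖iteratedFDeriv ℝ n u₀ (a • x)‖ₑ := by
      intro x
      have h1 : iteratedFDeriv ℝ n (dilData c a u₀) x =
          c • iteratedFDeriv ℝ n (fun y : E3 => u₀ (a • y)) x := by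
        unfold dilData
        exact iteratedFDeriv_const_smul_apply' (hcompn.contDiffAt)
      have h2 := norm_iteratedFDeriv_comp_smul_le u₀ ha n x
      rw [← ofReal_norm, ← ofReal_norm, h1, norm_smul, Real.norm_eq_abs,
        ← ENNReal.ofReal_mul (by positivity)]
      refine ENNReal.ofReal_le_ofReal ?_
      calc |c| * ‖iteratedFDeriv ℝ n (fun y : E3 => u₀ (a • y)) x‖
          ≤ |c| * (|a| ^ n * ‖iteratedFDeriv ℝ n u₀ (a • x)‖) :=
            mul_le_mul_of_nonneg_left h2 (abs_nonneg c)
        _ = |c| * |a| ^ n * ‖iteratedFDeriv ℝ n u₀ (a • x)‖ := by ring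
    calc ∫⁻ x, ‖iteratedFDeriv ℝ n (dilData c a u₀) x‖ₑ ^ 2
        ≤ ∫⁻ x, (ENNReal.ofReal (|c| * |a| ^ n) * ‖iteratedFDeriv ℝ n u₀ (a • x)‖ₑ) ^ 2 :=
          lintegral_mono fun x => pow_le_pow_left' (hpt x) 2
      _ = ENNReal.ofReal (|c| * |a| ^ n) ^ 2 * ∫⁻ x, ‖iteratedFDeriv ℝ n u₀ (a • x)‖ₑ ^ 2 := by
          simp_rw [mul_pow]
          rw [lintegral_const_mul' _ _ (ENNReal.pow_ne_top ENNReal.ofReal_ne_top)]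
      _ = ENNReal.ofReal (|c| * |a| ^ n) ^ 2 * (ENNReal.ofReal |(a ^ Module.finrank ℝ E3)⁻¹| *
            ∫⁻ x, ‖iteratedFDeriv ℝ n u₀ x‖ₑ ^ 2) := by
          rw [lintegral_comp_smul_R3 (fun y => ‖iteratedFDeriv ℝ n u₀ y‖ₑ ^ 2) ha]
      _ < ⊤ := ENNReal.mul_lt_top (ENNReal.pow_lt_top ENNReal.ofReal_lt_top)
          (ENNReal.mul_lt_top ENNReal.ofReal_lt_top (hH n))
  · -- divergence free
    intro x
    have hd : DifferentiableAt ℝ (fun y : E3 => u₀ (a • y)) x := (hcomp.differentiable (by simp)) x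
    show LinearMap.trace ℝ E3 (fderiv ℝ (dilData c a u₀) x : E3 →ₗ[ℝ] E3) = 0
    have hf : fderiv ℝ (dilData c a u₀) x = c • (a • fderiv ℝ u₀ (a • x)) := by
      unfold dilData
      rw [fderiv_fun_const_smul hd, fderiv_comp_smul u₀ ha x]
    rw [hf, ContinuousLinearMap.toLinearMap_smul, ContinuousLinearMap.toLinearMap_smul, map_smul,
      map_smul]
    have := hdiv (a • x)
    unfold NSWave0.divergence at this
    rw [this, smul_zero, smul_zero]

end Step1Certificate

/-! ## Kernel certificate for Step 10 — the `ν`-rescaling (T11.1 (11.1)–(11.2) p.131–133)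

«The functions (11.1) `u^ν(x,t;u_o) := u^{ν=1}(xν⁻¹, tν⁻¹; u_o(xν))`, `p^ν := p^{ν=1}(xν⁻¹, tν⁻¹; u_o(xν))`
in which `ν` is `> 0` are a `C^∞` solution of the (1.1)_{ν,u_o} equations on `ℝ³ × [0,∞)` … and (11.2)».
The content is the classical covariance of the Navier–Stokes system under the affine space–time
substitution `(t, x) ↦ (t/ν, x/ν)` WITHOUT amplitude factor (viscosity multiplied by `ν`): the case
`α = 1`, `β = γ = ν⁻¹`, `t₀ = 0`, `x₀ = 0` of the tree's PROVED `IsClassicalNSSolutionOn.stRescale`,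
transported through the wave-0 bridge `isNavierStokesSolution_and_smooth_iff`; plus the invariances of
the three `jenningsSpec.admissible` clauses under the spatial homothety `x ↦ ν⁻¹x` (`∩_m H^m` by the
chain rule in norm and Haar; the sup-seminorm `linf` by reparametrisation; `l2sq` by a common Haar
factor). Original source of the step: Leray's similarity bookkeeping (Leray 1934 §20; Tao 2013 Rem. 1.2).
This Step is the LAST binder `h10` of `claim_of_steps`; it is TRUE and not the adjudicated locator of
C20 (#49, `Step6b_JDilation`) — nothing in the verdict / locator / class / statements changes. FIRST
KERNEL PROOF (Summits side, not importable from `Literature/`):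
`Summit.NavierStokesRegularity.NavierStokesRegularity.Theorems.Jennings2020.step10_holds`
(`Theorems/SoloSalvageJennings2020NuRescaling.lean`, seat ns-claims-salvage-p2 g4, p512434) — this
in-file copy (same proof, helpers private) exists only so that the Literature-side fact
`Step10_NuRescaling` carries its `_holds` (D-0026 census). -/

section Step10Certificate

/-- **`∩_m H^m` is invariant under spatial homotheties**: if every derivative of `v : ℝ³ → F` is in
`L²`, so is every derivative of `x ↦ v(a x)`, `a ≠ 0` (`‖Dⁿ[v(a·)](x)‖ ≤ |a|ⁿ ‖Dⁿv(ax)‖` and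
`∫ g(ax) dx = |a|⁻³ ∫ g`). (Proof device.) [cite: Jennings2020, (9.3) p.109, (11.1) p.131] -/
private theorem isHInf_comp_smul {F : Type*} [NormedAddCommGroup F] [NormedSpace ℝ F] {v : E3 → F}
    (hv : IsHInf v) {a : ℝ} (ha : a ≠ 0) : IsHInf (fun x => v (a • x)) := by
  intro n
  have hpt : ∀ x : E3, ‖iteratedFDeriv ℝ n (fun y => v (a • y)) x‖ₑ ≤
      ENNReal.ofReal (|a| ^ n) * ‖iteratedFDeriv ℝ n v (a • x)‖ₑ := by
    intro x
    rw [← ofReal_norm, ← ofReal_norm, ← ENNReal.ofReal_mul (by positivity)]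
    exact ENNReal.ofReal_le_ofReal (norm_iteratedFDeriv_comp_smul_le v ha n x)
  calc ∫⁻ x, ‖iteratedFDeriv ℝ n (fun y => v (a • y)) x‖ₑ ^ 2
      ≤ ∫⁻ x, (ENNReal.ofReal (|a| ^ n) * ‖iteratedFDeriv ℝ n v (a • x)‖ₑ) ^ 2 :=
        lintegral_mono fun x => pow_le_pow_left' (hpt x) 2
    _ = ENNReal.ofReal (|a| ^ n) ^ 2 * ∫⁻ x, ‖iteratedFDeriv ℝ n v (a • x)‖ₑ ^ 2 := by
        simp_rw [mul_pow]
        rw [lintegral_const_mul' _ _ (ENNReal.pow_ne_top ENNReal.ofReal_ne_top)]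
    _ = ENNReal.ofReal (|a| ^ n) ^ 2 * (ENNReal.ofReal |(a ^ Module.finrank ℝ E3)⁻¹| *
          ∫⁻ x, ‖iteratedFDeriv ℝ n v x‖ₑ ^ 2) := by
        rw [lintegral_comp_smul_R3 (fun y => ‖iteratedFDeriv ℝ n v y‖ₑ ^ 2) ha]
    _ < ⊤ := ENNReal.mul_lt_top (ENNReal.pow_lt_top ENNReal.ofReal_lt_top)
        (ENNReal.mul_lt_top ENNReal.ofReal_lt_top (hv n))

/-- The sup-seminorm `linf` (a plain supremum over `ℝ³`) is invariant under the spatial homothety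
`x ↦ a x`, `a ≠ 0` (a bijection of `ℝ³`). (Proof device.) [cite: Jennings2020, §1 p.3, (11.2) p.131] -/
private theorem linf_comp_smul (v : E3 → E3) {a : ℝ} (ha : a ≠ 0) :
    linf (fun x => v (a • x)) = linf v := by
  unfold linf
  have hsurj : Function.Surjective (fun x : E3 => a • x) :=
    fun y => ⟨a⁻¹ • y, by simp [smul_smul, mul_inv_cancel₀ ha]⟩
  exact hsurj.iSup_comp (fun y => ⨆ k : Fin 3, ‖v y k‖ₑ)

/-- The `L²` mass `l2sq` scales under `x ↦ a x`, `a ≠ 0`, by the Haar factor `|a|⁻³`. (Proof device.)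
[cite: Jennings2020, (1.5) p.95, (11.2) p.131] -/
private theorem l2sq_comp_smul (v : E3 → E3) {a : ℝ} (ha : a ≠ 0) :
    l2sq (fun x => v (a • x)) = ENNReal.ofReal |(a ^ Module.finrank ℝ E3)⁻¹| * l2sq v := by
  unfold l2sq
  exact lintegral_comp_smul_R3 (fun y => ‖v y‖ₑ ^ 2) ha

/-- The (11.1) rescaling `(t, x) ↦ U(t/ν, x/ν)` IS the tree's affine pull-back `stPull ν⁻¹ ν⁻¹ 0 0 U`.
(Proof device.) [cite: Jennings2020, (11.1) p.131] -/
private theorem stPull_eq_rescale {F : Type*} (ν : ℝ) (W : ℝ → E3 → F) :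
    stPull ν⁻¹ ν⁻¹ 0 (0 : E3) W = rescale ν W := by
  funext s y
  simp [stPull_apply, rescale, div_eq_inv_mul]

/-- **Step 10 (T11.1 (11.1)–(11.2) p.131–133, the `ν`-rescaling) is a THEOREM.** Given `ν > 0`, a
datum `u_o ∈ ∩_m H^{m,df}`, and the `ν = 1` objects for the datum `u_o(xν)`, the rescaled pair
`u^ν(x,t) = U(xν⁻¹, tν⁻¹)`, `p^ν = (pOf U)(xν⁻¹, tν⁻¹)` is smooth on `ℝ³ × [0,∞)`, solves (1)–(3) at
viscosity `ν` from `u_o`, and satisfies the admissibility clauses of `jenningsSpec`. PDE part: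
`IsClassicalNSSolutionOn.stRescale` with `α = 1`, `β = γ = ν⁻¹` through
`isNavierStokesSolution_and_smooth_iff`; clauses by `isHInf_comp_smul`, `linf_comp_smul`,
`l2sq_comp_smul` at `a = ν⁻¹`. Literature-side twin of the Summits-side
`Summit.NavierStokesRegularity.NavierStokesRegularity.Theorems.Jennings2020.step10_holds` (p512434);
original source of the step: the scaling covariance of Navier–Stokes (Leray 1934 §20; Tao 2013
Rem. 1.2), not the claim. [cite: Jennings2020, T11.1 (11.1)–(11.2) p.131–133] -/
theorem step10_NuRescaling_holds : Step10_NuRescaling := by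
  intro ν hν u₀ _hu₀ U hU hUs hPs hPH hNS hlinf hl2
  have hν0 : ν ≠ 0 := hν.ne'
  have hνi : 0 < ν⁻¹ := inv_pos.2 hν
  have hνi0 : ν⁻¹ ≠ 0 := hνi.ne'
  -- the `ν = 1` solution as a classical solution on `[0, ∞)`
  obtain ⟨hcl, h0⟩ := isNavierStokesSolution_and_smooth_iff.mp ⟨hNS, hUs, hPs⟩
  -- Leray-type affine covariance with `α = 1`, `β = γ = ν⁻¹`
  have key := hcl.stRescale one_pos hνi (show ν⁻¹ = 1 * ν⁻¹ by rw [one_mul]) 0 (0 : E3)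
  have hS : ((fun r : ℝ => 0 + ν⁻¹ * r) ⁻¹' Ici (0 : ℝ)) = Ici 0 := by
    ext r
    simp only [mem_preimage, mem_Ici, zero_add]
    exact mul_nonneg_iff_of_pos_left hνi
  have hvisc : (1 : ℝ) * 1 / ν⁻¹ = ν := by rw [one_mul, one_div, inv_inv]
  have hf : ((1 : ℝ) ^ 2 * ν⁻¹) • stPull ν⁻¹ ν⁻¹ 0 (0 : E3) (0 : ℝ → E3 → E3) = 0 :=
    smul_stPull_zero _ _ _ _ _
  have hu : (1 : ℝ) • stPull ν⁻¹ ν⁻¹ 0 (0 : E3) U = rescale ν U := by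
    rw [one_smul, stPull_eq_rescale]
  have hp : (1 : ℝ) ^ 2 • stPull ν⁻¹ ν⁻¹ 0 (0 : E3) (pOf U) = rescale ν (pOf U) := by
    rw [one_pow, one_smul, stPull_eq_rescale]
  rw [hS, hvisc, hf, hu, hp] at key
  -- the datum: `U(0)(ν⁻¹ x) = u_o(ν ν⁻¹ x) = u_o(x)`
  have h0' : rescale ν U 0 = u₀ := by
    funext x
    have hinit : U 0 = dilData 1 ν u₀ := hU.init
    simp [rescale, hinit, dilData, smul_smul, mul_inv_cancel₀ hν0]
  obtain ⟨hns', hs', hps'⟩ := isNavierStokesSolution_and_smooth_iff.mpr ⟨key, h0'⟩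
  refine ⟨hs', hps', hns', ?_, ?_, ?_⟩
  · -- slices of `u^ν`, `p^ν` in `∩_m H^m`
    intro t ht
    have hst : t / ν ∈ strip ⊤ := ⟨div_nonneg ht hν.le, ENNReal.ofReal_lt_top⟩
    have h1 : IsHInf (U (t / ν)) := hU.hInf _ hst
    have h2 : IsHInf (pOf U (t / ν)) := hPH _ (div_nonneg ht hν.le)
    exact ⟨isHInf_comp_smul h1 hνi0, isHInf_comp_smul h2 hνi0⟩
  · -- (11.2), sup clause
    intro t ht
    show linf (fun x => U (t / ν) (ν⁻¹ • x)) ≤ linf (fun x => U (0 / ν) (ν⁻¹ • x))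
    rw [linf_comp_smul _ hνi0, linf_comp_smul _ hνi0, zero_div, hU.init]
    exact hlinf _ (div_nonneg ht hν.le)
  · -- (11.2), `L²` clause
    intro t ht
    show l2sq (fun x => U (t / ν) (ν⁻¹ • x)) ≤ l2sq (fun x => U (0 / ν) (ν⁻¹ • x))
    rw [l2sq_comp_smul _ hνi0, l2sq_comp_smul _ hνi0, zero_div, hU.init]
    exact mul_le_mul_right (hl2 _ (div_nonneg ht hν.le)) _

/-- `Step10_NuRescaling` — `_holds` alias of `step10_NuRescaling_holds` above under the fact's exact name (appended
2026-08-28, D-0026 bookkeeping: the proof term is the existing theorem of this file; no statement,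
definition or attribute is edited; no new named fact; the ledger's debt table listed the fact
unproved). [cite: Jennings2020, T11.1 (11.1)–(11.2) p.131–133] -/
theorem _root_.Literature.Claims.NS.Jennings2020.Step10_NuRescaling_holds : Step10_NuRescaling :=
  _root_.Literature.Claims.NS.Jennings2020.step10_NuRescaling_holds

end Step10Certificate

end Literature.Claims.NS.Jennings2020
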